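import Literature.MathematicalPhysics.QuantumLattice.HubbardNNNHoppingEnergyDensityConvex
import HarnessLib

/-!
# Density-chord upper bounds for the Hubbard thermodynamic-limit energy density

Corollaries of convexity in the density (`convexOn_energyDensityTT'`) and of the vacuum point
`e(t,t',U,0) ≤ 0` (`energyDensityTT'_density_zero_le`): for `0 ≤ U`, certified UPPER bounds at two
densities `n₁ < n₂` in `[0,2)` give the chord upper bound at every density between them, and one upper
bound at `n₂` gives `e(n) ≤ (n/n₂)·u₂` on `(0,n₂)` (the chord from the vacuum).  These are the by-name
forms of the "§1b free upper" rule used by the certified-bound tables (lower convex hull of signed upper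
points together with `(0,0)`).  [cite: Ruelle1969, §3.3]
-/

namespace Literature.MathematicalPhysics.QuantumLattice

namespace ThermodynamicLimit

open Set

/-- **Density-chord UPPER bound.** For `0 ≤ n₁ < n < n₂ < 2` and certified
upper bounds `e(n₁) ≤ u₁`, `e(n₂) ≤ u₂`: `e(n) ≤ ((n₂ - n) u₁ + (n - n₁) u₂)/(n₂ - n₁)`
(convexity: `e` lies below its chords). [cite: Ruelle1969, §3.3] -/
theorem energyDensityTT'_le_density_chord (t t' : ℝ) {U : ℝ} (hU : 0 ≤ U)
    {n₁ n n₂ u₁ u₂ : ℝ} (hn₁ : 0 ≤ n₁) (h₁ : n₁ < n) (h₂ : n < n₂) (hn₂ : n₂ < 2)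
    (hu₁ : energyDensityTT' t t' U n₁ ≤ u₁) (hu₂ : energyDensityTT' t t' U n₂ ≤ u₂) :
    energyDensityTT' t t' U n ≤ ((n₂ - n) * u₁ + (n - n₁) * u₂) / (n₂ - n₁) := by
  have hd : 0 < n₂ - n₁ := by linarith
  set p : ℝ := (n₂ - n) / (n₂ - n₁) with hp'
  set q : ℝ := (n - n₁) / (n₂ - n₁) with hq'
  have hp : 0 ≤ p := div_nonneg (by linarith) hd.le
  have hq : 0 ≤ q := div_nonneg (by linarith) hd.le
  have hpq : p + q = 1 := by
    rw [hp', hq', ← add_div, div_eq_one_iff_eq hd.ne']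
    ring
  have hc := (convexOn_energyDensityTT' t t' hU).2 (show n₁ ∈ Ico (0 : ℝ) 2 from ⟨hn₁, by linarith⟩)
    (show n₂ ∈ Ico (0 : ℝ) 2 from ⟨by linarith, hn₂⟩) hp hq hpq
  simp only [smul_eq_mul] at hc
  have hn : p * n₁ + q * n₂ = n := by
    rw [hp', hq']
    field_simp
    ring
  rw [hn] at hc
  have e1 : ((n₂ - n) * u₁ + (n - n₁) * u₂) / (n₂ - n₁) = p * u₁ + q * u₂ := by
    rw [hp', hq']
    field_simp
  rw [e1]
  have h1 := mul_le_mul_of_nonneg_left hu₁ hp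
  have h2 := mul_le_mul_of_nonneg_left hu₂ hq
  linarith

/-- **Vacuum-chord UPPER bound.** For `0 < n < n₂ < 2` and a certified upper bound `e(n₂) ≤ u₂`:
`e(n) ≤ (n / n₂) u₂` — the chord from the vacuum point `e(0) ≤ 0`
(`energyDensityTT'_density_zero_le`). [cite: Ruelle1969, §3.3] -/
theorem energyDensityTT'_le_vacuum_chord (t t' : ℝ) {U : ℝ} (hU : 0 ≤ U)
    {n n₂ u₂ : ℝ} (h₁ : 0 < n) (h₂ : n < n₂) (hn₂ : n₂ < 2)
    (hu₂ : energyDensityTT' t t' U n₂ ≤ u₂) :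
    energyDensityTT' t t' U n ≤ n / n₂ * u₂ := by
  have h := energyDensityTT'_le_density_chord t t' hU (n₁ := 0) (u₁ := 0) le_rfl h₁ h₂ hn₂
    (energyDensityTT'_density_zero_le t t' hU) hu₂
  simp only [sub_zero, mul_zero, zero_add] at h
  rw [show n / n₂ * u₂ = n * u₂ / n₂ by ring]
  exact h

/-- `t' = 0` specialisation of the density chord in the `energyDensity2D` spelling of the certified rows.
[cite: Ruelle1969, §3.3] -/
theorem energyDensity2D_le_density_chord (t : ℝ) {U : ℝ} (hU : 0 ≤ U)
    {n₁ n n₂ u₁ u₂ : ℝ} (hn₁ : 0 ≤ n₁) (h₁ : n₁ < n) (h₂ : n < n₂) (hn₂ : n₂ < 2)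
    (hu₁ : energyDensity2D t U n₁ ≤ u₁) (hu₂ : energyDensity2D t U n₂ ≤ u₂) :
    energyDensity2D t U n ≤ ((n₂ - n) * u₁ + (n - n₁) * u₂) / (n₂ - n₁) := by
  rw [← energyDensityTT'_zero] at hu₁ hu₂ ⊢
  exact energyDensityTT'_le_density_chord t 0 hU hn₁ h₁ h₂ hn₂ hu₁ hu₂

/-- `t' = 0` specialisation of the vacuum chord in the `energyDensity2D` spelling of the certified
rows. [cite: Ruelle1969, §3.3] -/
theorem energyDensity2D_le_vacuum_chord (t : ℝ) {U : ℝ} (hU : 0 ≤ U)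
    {n n₂ u₂ : ℝ} (h₁ : 0 < n) (h₂ : n < n₂) (hn₂ : n₂ < 2)
    (hu₂ : energyDensity2D t U n₂ ≤ u₂) :
    energyDensity2D t U n ≤ n / n₂ * u₂ := by
  rw [← energyDensityTT'_zero] at hu₂ ⊢
  exact energyDensityTT'_le_vacuum_chord t 0 hU h₁ h₂ hn₂ hu₂

end ThermodynamicLimit

end Literature.MathematicalPhysics.QuantumLattice
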